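import Literature.NumberTheory.Automorphic.ClozelAlgebraicityHeckeFieldResFiniteProofs
import Literature.NumberTheory.Automorphic.AutomorphicRepsGLSatakeScalars
import Literature.NumberTheory.Automorphic.AutomorphicRepsGLSatakeFlathProofs
import Literature.NumberTheory.Automorphic.CuspidalCohomologyGLRankOneCharacter
import Summits.Langlands.Langlands.Theorems.IrreducibilityBySelfDualityHeckeEigenvalueFieldConditional
import HarnessLib

/-!
# `HeckeEigenvalueField` from the Eichler–Shimura–Borel COMPARISON in rank `≥ 2` and Borel–Serre
# (item stmt-Langlands-13632, line `Sketch` v5, `--supports`, conditional-result)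

Line `Sketch` (lead skeleton `Cruxes/HeckeEigenvalueField/Lines/Sketch.lean`) closes the crux
`IrreducibilityBySelfDuality.HeckeEigenvalueField` (= `Clozel1990_heckeEigenvalueField` verbatim)
modulo two named facts: `BorelSerre1973_finiteDimensional_groupCohomology_congruenceSubgroup` (B)
and `ResGLnCohomology.cuspidalEigenclass_exists` restricted to `n ≥ 2` (A; its `n = 1` slice is the
theorem `ResGLnCohomology.cuspidalEigenclass_exists_rank_one`), see `…ResClosure.lean` and
`ClozelAlgebraicityHeckeFieldResFiniteProofs.lean`.

The printed proof of A has two halves [cite: Clozel1990, Lemme 3.15 and §3.5 (p. 123)]: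

* AUTOMORPHIC half (Satake, Flath): on the `K(𝔫)`-invariants of `π = W / W'` every double coset
  `T_{v,i}(ϖ_v) = [K(𝔫) t_{v,i}(ϖ_v) K(𝔫)]`, `v ∤ 𝔫`, acts modulo `W'` by ONE scalar, equal to
  `q_v^{i(n−i)/2} e_i(α)` for every Satake parameter `α` of `π` at `v` — a THEOREM of the tree
  (`AutomorphicRepData.Flath1979_heckeOperator_ofLocal_sub_smul_mem_holds`,
  `AutomorphicRepData.HasSatakeParamAt.eq_esymm_of_sub_smul_mem`);
* COMPARISON half (Borel–Wallach VII 2.7, Borel's regularization, Clozel's Lemme 3.14): a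
  `K(𝔫)`-spherical eigenform `φ ∈ W ∖ W'` modulo `W'` of the `T_{v,i}(ϖ_v)` with eigenvalues `c_{v,i}`
  gives a NON-ZERO class `x ∈ H^q(S_{K_f(𝔫)}, Ẽ_λ)` with `T_{v,i} x = c_{v,i} x` — not in the tree.

Following the tree's all-rank reduction `ResGLnCohomology.cuspidalEigenclass_exists_of_eigenformComparison`
(`ResGLnCuspidalEigenclassOfComparison.lean`), this file slices it to `n ≥ 2` — the exact residue of the
line — and composes:

* `cuspidalEigenclass_rank_two_of_eigenformComparison` — A for `n ≥ 2` from the comparison for `n ≥ 2`;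
* `clozel1990_heckeEigenvalueField_of_eigenformComparison_rank_two_of_borelSerre` — the comparison
  for `n ≥ 2` and B imply `Clozel1990_heckeEigenvalueField`;
* `HeckeEigenvalueField_of_eigenformComparison_rank_two_of_borelSerre` — the same against the ROUTE
  DECL BY NAME (conditional-result; the trust base of the crux along line `Sketch` v5 is exactly
  {comparison for one spherical eigenform, `n ≥ 2`; Borel–Serre}).

This module imports the Theses file (through `…Conditional.lean`) and is therefore not to be
imported by a module that closes an item of this route by name.
-/

set_option linter.dupNamespace false -- project-wide: `Summit.Langlands.Langlands` is the mandated namespace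

noncomputable section

open scoped Classical
open NumberField IsDedekindDomain
open Literature.NumberTheory.Automorphic Literature.NumberTheory.DiophantineGeometry
  Literature.Barriers.Langlands

namespace Summit.Langlands.Langlands.Theorems.HeckeEigenvalueField.Res

open ResGLnCohomology BigHeckeGLn

/-- **Fact A in rank `≥ 2` from the comparison in rank `≥ 2`.**  Hypothesis `hC` = the hypothesis
`h` of `ResGLnCohomology.cuspidalEigenclass_exists_of_eigenformComparison` restricted to `2 ≤ n`: for
a level `𝔫 ≠ 0`, dominant weights `λ`, a cuspidal `π` on `GL_n(𝔸_K)` whose infinity type has the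
`a`-multisets of the cohomological type of `λ_τ^∨` at every `τ`, and a `K(𝔫)`-invariant form
`φ ∈ W ∖ W'` which is an eigenform modulo `W'` of the double cosets `T_{v,i}(ϖ_v)`
(`heckeDiagAt n K v (uniformizerAt v) i`), `v ∤ 𝔫`, `i ≤ n`, with eigenvalues `c_{v,i}`, some degree
`q` carries a non-zero `x ∈ H^q(S_{K_f(𝔫)}, Ẽ_λ)` (`levelCohomology ℂ n K 𝔫 λ q`) with
`T_{v,i} x = c_{v,i} x` (`heckeT`).  Conclusion: the text of `ResGLnCohomology.cuspidalEigenclass_exists`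
for `2 ≤ n` — the scalars `c_{v,i}` exist for every `K(𝔫)`-invariant form
(`Flath1979_heckeOperator_ofLocal_sub_smul_mem_holds`) and are the Satake–Tamagawa eigenvalues of
every Satake parameter of `π` at `v` (`HasSatakeParamAt.eq_esymm_of_sub_smul_mem`).
[cite: Clozel1990, Lemme 3.14, Lemme 3.15 and §3.5 (pp. 120–123)] [cite: FlathCorvallis1979, Thm. 3]
[cite: BorelWallach2000, VII 2.5–2.7] [cite: Borel1983Regularization, Thm. 5.3 and Cor. 5.5] -/
theorem cuspidalEigenclass_rank_two_of_eigenformComparison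
    (hC : ∀ (n : ℕ) (K : Type) [Field K] [NumberField K] (hcpt : isCompact_glFiniteIntegralLevel n K)
      (𝔫 : Ideal (𝓞 K)) (lam : (K →+* ℂ) → Fin n → ℤ), 2 ≤ n → 𝔫 ≠ 0 →
      (∀ τ, Weight.IsDominant (lam τ)) →
      ∀ π : CuspidalAutomorphicRepData n K hcpt,
        (∃ T : InfinityType K n, π.1.HasInfinityType T ∧
          ∀ τ : K →+* ℂ, (T τ).map ArchWeight.a =
            (cohomologicalInfinityType n K (Weight.dual (lam τ)) τ).map ArchWeight.a) →
        ∀ φ ∈ π.1.W, φ ∉ π.1.W' →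
          (∀ u ∈ principalCongruenceLevel n K 𝔫,
            rightTranslation (AdelicGroupData.gl n K) u φ = φ) →
          ∀ c : HeightOneSpectrum (𝓞 K) → ℕ → ℂ,
            (∀ v : HeightOneSpectrum (𝓞 K), ¬ v.asIdeal ∣ 𝔫 → ∀ i ≤ n,
              heckeOperator (rightTranslation (AdelicGroupData.gl n K))
                  (principalCongruenceLevel n K 𝔫)
                  (heckeDiagAt n K v (uniformizerAt v) i) φ - c v i • φ ∈ π.1.W') →
            ∃ (q : ℕ) (x : levelCohomology ℂ n K 𝔫 lam q), x ≠ 0 ∧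
              ∀ v : HeightOneSpectrum (𝓞 K), ¬ v.asIdeal ∣ 𝔫 → ∀ i ≤ n,
                heckeT ℂ n K 𝔫 lam q v i x = c v i • x) :
    ∀ (n : ℕ) (K : Type) [Field K] [NumberField K] (hcpt : isCompact_glFiniteIntegralLevel n K)
      (𝔫 : Ideal (𝓞 K)) (lam : (K →+* ℂ) → Fin n → ℤ), 2 ≤ n → 𝔫 ≠ 0 →
      (∀ τ, Weight.IsDominant (lam τ)) →
      ∀ π : CuspidalAutomorphicRepData n K hcpt,
        (∃ T : InfinityType K n, π.1.HasInfinityType T ∧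
          ∀ τ : K →+* ℂ, (T τ).map ArchWeight.a =
            (cohomologicalInfinityType n K (Weight.dual (lam τ)) τ).map ArchWeight.a) →
        (∃ φ ∈ π.1.W, φ ∉ π.1.W' ∧
          ∀ u ∈ principalCongruenceLevel n K 𝔫, rightTranslation (AdelicGroupData.gl n K) u φ = φ) →
        ∃ (q : ℕ) (x : levelCohomology ℂ n K 𝔫 lam q), x ≠ 0 ∧
          ∀ v : HeightOneSpectrum (𝓞 K), ¬ v.asIdeal ∣ 𝔫 → ∀ α : Multiset ℂ,
            π.1.HasSatakeParamAt v α → ∀ i ≤ n,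
              heckeT ℂ n K 𝔫 lam q v i x = heckeEigenvalueOf n v α i • x := by
  intro n K _ _ hcpt 𝔫 lam hn h𝔫 hlam π hT hφ
  obtain ⟨φ, hφW, hφW', hfix⟩ := hφ
  -- the automorphic half: the scalars of `T_{v,i}(ϖ_v)` modulo `W'` on the `K(𝔫)`-invariants
  have hS := π.1.Flath1979_heckeOperator_ofLocal_sub_smul_mem_holds
  choose c hc using fun (v : HeightOneSpectrum (𝓞 K)) (i : ℕ) =>
    hS v (glDiagonal n (v.adicCompletion K) fun k => if (k : ℕ) < i then uniformizerAt v else 1)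
  have hcφ : ∀ v : HeightOneSpectrum (𝓞 K), ¬ v.asIdeal ∣ 𝔫 → ∀ i ≤ n,
      heckeOperator (rightTranslation (AdelicGroupData.gl n K)) (principalCongruenceLevel n K 𝔫)
          (heckeDiagAt n K v (uniformizerAt v) i) φ - c v i • φ ∈ π.1.W' := by
    intro v hv i _
    rw [heckeDiagAt_eq_ofLocal_glDiagonal]
    exact hc v i h𝔫 hv φ hφW hfix
  -- the comparison for `φ`
  obtain ⟨q, x, hx, heig⟩ := hC n K hcpt 𝔫 lam hn h𝔫 hlam π hT φ hφW hφW' hfix c hcφ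
  refine ⟨q, x, hx, fun v hv α hα i hi => ?_⟩
  rw [heig v hv i hi, hα.eq_esymm_of_sub_smul_mem hS h𝔫 hv (BigHeckeGLn.valued_uniformizerAt v)
    hφW hφW' hfix hi (hcφ v hv i hi)]
  rfl

/-- **Clozel's Hecke-field theorem from the comparison in rank `≥ 2` and Borel–Serre**:
`cuspidalEigenclass_rank_two_of_eigenformComparison` fed into the Literature residue theorem
`Clozel1990_heckeEigenvalueField_of_cuspidalEigenclass_rank_two_of_borelSerre` (rank one being the
theorem `ResGLnCohomology.cuspidalEigenclass_exists_rank_one`, the composition being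
`Clozel1990_heckeEigenvalueField_of_resRealisation`). [cite: Clozel1990, Thm. 3.13 (proof, §3.5 pp. 120–123)] -/
theorem clozel1990_heckeEigenvalueField_of_eigenformComparison_rank_two_of_borelSerre
    (hC : ∀ (n : ℕ) (K : Type) [Field K] [NumberField K] (hcpt : isCompact_glFiniteIntegralLevel n K)
      (𝔫 : Ideal (𝓞 K)) (lam : (K →+* ℂ) → Fin n → ℤ), 2 ≤ n → 𝔫 ≠ 0 →
      (∀ τ, Weight.IsDominant (lam τ)) →
      ∀ π : CuspidalAutomorphicRepData n K hcpt,
        (∃ T : InfinityType K n, π.1.HasInfinityType T ∧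
          ∀ τ : K →+* ℂ, (T τ).map ArchWeight.a =
            (cohomologicalInfinityType n K (Weight.dual (lam τ)) τ).map ArchWeight.a) →
        ∀ φ ∈ π.1.W, φ ∉ π.1.W' →
          (∀ u ∈ principalCongruenceLevel n K 𝔫,
            rightTranslation (AdelicGroupData.gl n K) u φ = φ) →
          ∀ c : HeightOneSpectrum (𝓞 K) → ℕ → ℂ,
            (∀ v : HeightOneSpectrum (𝓞 K), ¬ v.asIdeal ∣ 𝔫 → ∀ i ≤ n,
              heckeOperator (rightTranslation (AdelicGroupData.gl n K))
                  (principalCongruenceLevel n K 𝔫)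
                  (heckeDiagAt n K v (uniformizerAt v) i) φ - c v i • φ ∈ π.1.W') →
            ∃ (q : ℕ) (x : levelCohomology ℂ n K 𝔫 lam q), x ≠ 0 ∧
              ∀ v : HeightOneSpectrum (𝓞 K), ¬ v.asIdeal ∣ 𝔫 → ∀ i ≤ n,
                heckeT ℂ n K 𝔫 lam q v i x = c v i • x)
    (hB : BorelSerre1973_finiteDimensional_groupCohomology_congruenceSubgroup) :
    Clozel1990_heckeEigenvalueField :=
  Clozel1990_heckeEigenvalueField_of_cuspidalEigenclass_rank_two_of_borelSerre
    (cuspidalEigenclass_rank_two_of_eigenformComparison hC) hB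

/-- **The route decl `IrreducibilityBySelfDuality.HeckeEigenvalueField` BY NAME from the comparison
in rank `≥ 2` and Borel–Serre** (conditional closure of item stmt-Langlands-13632 along line `Sketch`
v5; the route decl is `Clozel1990_heckeEigenvalueField` verbatim,
`route_heckeEigenvalueField_of_clozel1990`). [cite: Clozel1990, Thm. 3.13] -/
theorem HeckeEigenvalueField_of_eigenformComparison_rank_two_of_borelSerre
    (hC : ∀ (n : ℕ) (K : Type) [Field K] [NumberField K] (hcpt : isCompact_glFiniteIntegralLevel n K)
      (𝔫 : Ideal (𝓞 K)) (lam : (K →+* ℂ) → Fin n → ℤ), 2 ≤ n → 𝔫 ≠ 0 →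
      (∀ τ, Weight.IsDominant (lam τ)) →
      ∀ π : CuspidalAutomorphicRepData n K hcpt,
        (∃ T : InfinityType K n, π.1.HasInfinityType T ∧
          ∀ τ : K →+* ℂ, (T τ).map ArchWeight.a =
            (cohomologicalInfinityType n K (Weight.dual (lam τ)) τ).map ArchWeight.a) →
        ∀ φ ∈ π.1.W, φ ∉ π.1.W' →
          (∀ u ∈ principalCongruenceLevel n K 𝔫,
            rightTranslation (AdelicGroupData.gl n K) u φ = φ) →
          ∀ c : HeightOneSpectrum (𝓞 K) → ℕ → ℂ,
            (∀ v : HeightOneSpectrum (𝓞 K), ¬ v.asIdeal ∣ 𝔫 → ∀ i ≤ n,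
              heckeOperator (rightTranslation (AdelicGroupData.gl n K))
                  (principalCongruenceLevel n K 𝔫)
                  (heckeDiagAt n K v (uniformizerAt v) i) φ - c v i • φ ∈ π.1.W') →
            ∃ (q : ℕ) (x : levelCohomology ℂ n K 𝔫 lam q), x ≠ 0 ∧
              ∀ v : HeightOneSpectrum (𝓞 K), ¬ v.asIdeal ∣ 𝔫 → ∀ i ≤ n,
                heckeT ℂ n K 𝔫 lam q v i x = c v i • x)
    (hB : BorelSerre1973_finiteDimensional_groupCohomology_congruenceSubgroup) :
    Summit.Langlands.Langlands.Theses.IrreducibilityBySelfDuality.HeckeEigenvalueField :=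
  route_heckeEigenvalueField_of_clozel1990
    (clozel1990_heckeEigenvalueField_of_eigenformComparison_rank_two_of_borelSerre hC hB)

end Summit.Langlands.Langlands.Theorems.HeckeEigenvalueField.Res

end
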